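import Summits.Langlands.Langlands.Theses.ParityBlindBianchi
import Literature.FieldTheory.AlgClosed.PadicAlgClEquivComplex

/-!
# Route ParityBlindBianchi — the glue item `EvenIcosahedralFromBianchi`

Item `stmt-Langlands-14458` (support of route `route-Langlands-ParityBlindBianchi`): the four chain
items `ResidualBianchiDoorMod2`, `TwoAdicBianchiProModularity`, `ArtinWeightRealisation`,
`IcosahedralQuadraticDescent` imply the target `EvenIcosahedralStrongArtin` by name.

The proof is bookkeeping in pure logic. The only non-logical ingredient is an abstract field
isomorphism `ι : ℚ̄₂ ≃+* ℂ`, which is the tree theorem `PadicAlgCl.nonempty_ringEquiv_complex`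
(Steinitz: both fields are algebraically closed of characteristic `0` and cardinality `𝔠`).
Given `ρ` irreducible icosahedral over `ℚ` (the evenness hypothesis of the target is not consumed),
`IcosahedralQuadraticDescent` reduces the target to producing, for every imaginary quadratic `K`
with `2` split, a `2`-adic model `σ` of `ρ|_K` through `ι` together with a cuspidal `π_K` of
`GL₂(𝔸_K)` that is Satake–Frobenius compatible with `σ` almost everywhere;
`ResidualBianchiDoorMod2` supplies `σ` (finite image, irreducible, projective image `A₅`,
residually automorphic over `K` in cohomological weight); `TwoAdicBianchiProModularity` turns this
into a continuous `ℤ̄₂`-point of the big Hecke algebra Hansen-associated with `σ`; and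
`ArtinWeightRealisation` at `p = 2` returns `π_K`.

Record (2026-08-17, dependency-drift repair): the item and its four chain decls were DROPPED from the
route at rev 8 (crux-only deciding theorem with level-pinned successors); the five names below are since
then file-local notations for the dropped items' statements (see the comment after the `open` line), so
the theorem keeps its text and proves the same chain; nothing else changed.
-/

set_option linter.dupNamespace false -- project-wide option (lakefile weak.linter.dupNamespace); `Summit.Langlands.Langlands` is the mandated namespace

namespace Summit.Langlands.Langlands.Theorems

open Summit.Langlands.Langlands.Theses.ParityBlindBianchi

open scoped BigOperators Topology Manifold Classical MeasureTheory ProbabilityTheory Matrix InnerProductSpace ComplexConjugate ContinuousMap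
open Filter Set Function TopologicalSpace MeasureTheory

/- **The dropped glue item and its four chain items, verbatim, as local notations.** Route rev 8
(2026-08-16T07:53Z, crux-only deciding theorem + level control) DROPPED the glue item
`EvenIcosahedralFromBianchi` (stmt-Langlands-14458, closed · proved by the theorem below @ e83791f17f74)
together with the four chain decls it names — `ResidualBianchiDoorMod2` (stmt-Langlands-13459, moot),
`TwoAdicBianchiProModularity` (stmt-Langlands-13457, moot), `ArtinWeightRealisation` (stmt-Langlands-11057,
still an open item elsewhere, no longer a decl of this route) and `IcosahedralQuadraticDescent`
(stmt-Langlands-13461, moot); the route now works with their level-pinned successors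
(`ResidualBianchiDoorLevel`, `TwoAdicBianchiProModularityLevel`, `ArtinWeightRealisationLevel`,
`IcosahedralDescentLevel`, …). No constant of the five old names exists any more. To keep the landed
theorem letter for letter (Theorems files are append-only) without declaring propositions in a Theorems
file, the five tokens are file-LOCAL NOTATIONS expanding to the statements of the dropped items, verbatim
from their ledger signatures (the four chain items first, then the glue, whose signature names them); the
elaborated type of `EvenIcosahedralFromBianchi_proof` therefore carries the whole rev-7 chain
"residual door mod 2 → 2-adic Bianchi pro-modularity → Artin-weight realisation → icosahedral quadratic
descent → strong Artin for even icosahedral ρ" itself, with the live target `EvenIcosahedralStrongArtin`.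
(`quotPrecheck` is off for these commands only: the binder notations have no precheck handler; the names
in the bodies are as rendered by the gate in the route file's `open` context, reproduced above.)
Dependency-drift repair 2026-08-17; the proof lost only its `unfold` line. -/
set_option quotPrecheck false in
local notation "ResidualBianchiDoorMod2" =>
  (∀ (ι : PadicAlgCl 2 ≃+* ℂ) (ρ : Literature.NumberTheory.GaloisRepresentations.FramedGaloisRep ℚ ℂ 2), ρ.toGaloisRep.IsIrreducible → Nonempty ((Matrix.ProjGenLinGroup.mk.comp ρ.toMonoidHom).range ≃* alternatingGroup (Fin 5)) → ∀ (K : Type) [Field K] [NumberField K], NumberField.IsTotallyComplex K → Module.finrank ℚ K = 2 → (∃ v w : IsDedekindDomain.HeightOneSpectrum (NumberField.RingOfIntegers K), v ≠ w ∧ ((2 : ℕ) : NumberField.RingOfIntegers K) ∈ v.asIdeal ∧ ((2 : ℕ) : NumberField.RingOfIntegers K) ∈ w.asIdeal) → ∃ σ : Literature.NumberTheory.GaloisRepresentations.FramedGaloisRep K (PadicAlgCl 2) 2, (∀ (g : Field.absoluteGaloisGroup K) (i j : Fin 2), ι ((σ g).val i j) = ((Literature.NumberTheory.GaloisRepresentations.FramedGaloisRep.restrictField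 K ρ) g).val i j) ∧ Finite σ.toMonoidHom.range ∧ σ.toGaloisRep.IsIrreducible ∧ Nonempty ((Matrix.ProjGenLinGroup.mk.comp σ.toMonoidHom).range ≃* alternatingGroup (Fin 5)) ∧ (∃ (hcpt : Literature.NumberTheory.Automorphic.isCompact_glFiniteIntegralLevel 2 K) (π₀ : Literature.NumberTheory.Automorphic.CuspidalAutomorphicRepData 2 K hcpt), π₀.1.IsRegularAlgebraic ∧ (∀ᶠ v : IsDedekindDomain.HeightOneSpectrum (NumberField.RingOfIntegers K) in Filter.cofinite, ∃ (α : Multiset ℂ) (P : Polynomial (PadicAlgCl 2)), π₀.1.HasSatakeParamAt v α ∧ σ.IsUnramifiedAt v ∧ σ.HasFrobCharpolyAt v P ∧ ∀ i : ℕ, ‖P.coeff i - (Literature.NumberTheory.Automorphic.arithFrobPolyOfSatake ι v.residueCard 2 α).coeff i‖ < 1)))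

set_option quotPrecheck false in
local notation "TwoAdicBianchiProModularity" =>
  (∀ (K : Type) [Field K] [NumberField K], NumberField.IsTotallyComplex K → Module.finrank ℚ K = 2 → (∃ v w : IsDedekindDomain.HeightOneSpectrum (NumberField.RingOfIntegers K), v ≠ w ∧ ((2 : ℕ) : NumberField.RingOfIntegers K) ∈ v.asIdeal ∧ ((2 : ℕ) : NumberField.RingOfIntegers K) ∈ w.asIdeal) → ∀ (ι : PadicAlgCl 2 ≃+* ℂ) (σ : Literature.NumberTheory.GaloisRepresentations.FramedGaloisRep K (PadicAlgCl 2) 2), Finite σ.toMonoidHom.range → σ.toGaloisRep.IsIrreducible → Nonempty ((Matrix.ProjGenLinGroup.mk.comp σ.toMonoidHom).range ≃* alternatingGroup (Fin 5)) → (∃ (hcpt : Literature.NumberTheory.Automorphic.isCompact_glFiniteIntegralLevel 2 K) (π₀ : Literature.NumberTheory.Automorphic.CuspidalAutomorphicRepData 2 K hcpt), π₀.1.IsRegularAlgebraic ∧ (∀ᶠ v : IsDedekindDomain.HeightOneSpectrum (NumberField.RingOfIntegers K) in Filter.cofinite, ∃ (α : Multiset ℂ) (P : Polynomial (PadicAlgCl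 2)), π₀.1.HasSatakeParamAt v α ∧ σ.IsUnramifiedAt v ∧ σ.HasFrobCharpolyAt v P ∧ ∀ i : ℕ, ‖P.coeff i - (Literature.NumberTheory.Automorphic.arithFrobPolyOfSatake ι v.residueCard 2 α).coeff i‖ < 1)) → (∃ (S : Finset (IsDedekindDomain.HeightOneSpectrum (NumberField.RingOfIntegers K))) (U : Subgroup (GL (Fin 2) (IsDedekindDomain.FiniteAdeleRing (NumberField.RingOfIntegers K) K))) (ϖ : ∀ v : IsDedekindDomain.HeightOneSpectrum (NumberField.RingOfIntegers K), (v.adicCompletion K)ˣ) (a : {v : IsDedekindDomain.HeightOneSpectrum (NumberField.RingOfIntegers K) // v ∉ S} → ℕ → (Valued.v (R := PadicAlgCl 2)).valuationSubring), (∀ v : IsDedekindDomain.HeightOneSpectrum (NumberField.RingOfIntegers K), ((2 : ℕ) : NumberField.RingOfIntegers K) ∈ v.asIdeal → v ∈ S) ∧ IsOpen (U : Set (GL (Fin 2) (IsDedekindDomain.FiniteAdeleRing (NumberField.RingOfIntegers K) K))) ∧ U ≤ Literature.NumberTheory.Automorphic.glFiniteIntegralLevel 2 K ∧ (∀ g ∈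 Literature.NumberTheory.Automorphic.glFiniteIntegralLevel 2 K, (∀ v ∈ S, ∀ i j : Fin 2, ((g : Matrix (Fin 2) (Fin 2) (IsDedekindDomain.FiniteAdeleRing (NumberField.RingOfIntegers K) K)) i j) v = (1 : Matrix (Fin 2) (Fin 2) (v.adicCompletion K)) i j) → g ∈ U) ∧ (∀ v : IsDedekindDomain.HeightOneSpectrum (NumberField.RingOfIntegers K), Valued.v ((ϖ v : (v.adicCompletion K)ˣ) : v.adicCompletion K) = WithZero.exp (-1 : ℤ)) ∧ Literature.NumberTheory.Automorphic.IsHeckePoint (Matrix.GeneralLinearGroup.map (n := Fin 2) (algebraMap K (IsDedekindDomain.FiniteAdeleRing (NumberField.RingOfIntegers K) K))) (Literature.NumberTheory.Automorphic.LevelTower.ofSeq U (fun r : ℕ => (Literature.NumberTheory.Automorphic.principalCongruenceLevel 2 K (Ideal.span {((2 : ℕ) : NumberField.RingOfIntegers K)} ^ r)).map (Literature.NumberTheory.Automorphic.GLn.sndHom 2 K))) ((2 : ℕ) : (Valued.v (R := PadicAlgCl 2)).valuationSubring) (fun j : {v : IsDedekindDomain.HeightOneSpectrum (NumberField.RingOfIntegers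 K) // v ∉ S} × Fin 2 => Literature.NumberTheory.Automorphic.GLn.sndHom 2 K (Literature.NumberTheory.Automorphic.heckeDiagAt 2 K j.1.1 (ϖ j.1.1) (j.2.val + 1))) (fun j => a j.1 (j.2.val + 1)) ∧ ∀ (v : IsDedekindDomain.HeightOneSpectrum (NumberField.RingOfIntegers K)) (hv : v ∉ S), σ.IsHeckeAssociatedAt v (fun i : ℕ => if i = 0 then (1 : PadicAlgCl 2) else ((a ⟨v, hv⟩ i : (Valued.v (R := PadicAlgCl 2)).valuationSubring) : PadicAlgCl 2))))

set_option quotPrecheck false in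
local notation "ArtinWeightRealisation" =>
  (∀ (K : Type) [Field K] [NumberField K], NumberField.IsTotallyComplex K → Module.finrank ℚ K = 2 → ∀ (p : ℕ) [Fact p.Prime] (ι : PadicAlgCl p ≃+* ℂ) (σ : Literature.NumberTheory.GaloisRepresentations.FramedGaloisRep K (PadicAlgCl p) 2), Finite σ.toMonoidHom.range → σ.toGaloisRep.IsIrreducible → (∃ (S : Finset (IsDedekindDomain.HeightOneSpectrum (NumberField.RingOfIntegers K))) (U : Subgroup (GL (Fin 2) (IsDedekindDomain.FiniteAdeleRing (NumberField.RingOfIntegers K) K))) (ϖ : ∀ v : IsDedekindDomain.HeightOneSpectrum (NumberField.RingOfIntegers K), (v.adicCompletion K)ˣ) (a : {v : IsDedekindDomain.HeightOneSpectrum (NumberField.RingOfIntegers K) // v ∉ S} → ℕ → (Valued.v (R := PadicAlgCl p)).valuationSubring), (∀ v : IsDedekindDomain.HeightOneSpectrum (NumberField.RingOfIntegers K), ((p : ℕ) : NumberField.RingOfIntegers K) ∈ v.asIdeal → v ∈ S) ∧ IsOpen (U : Set (GL (Fin 2) (IsDedekindDomain.FiniteAdeleRing (NumberField.RingOfIntegers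 K) K))) ∧ U ≤ Literature.NumberTheory.Automorphic.glFiniteIntegralLevel 2 K ∧ (∀ g ∈ Literature.NumberTheory.Automorphic.glFiniteIntegralLevel 2 K, (∀ v ∈ S, ∀ i j : Fin 2, ((g : Matrix (Fin 2) (Fin 2) (IsDedekindDomain.FiniteAdeleRing (NumberField.RingOfIntegers K) K)) i j) v = (1 : Matrix (Fin 2) (Fin 2) (v.adicCompletion K)) i j) → g ∈ U) ∧ (∀ v : IsDedekindDomain.HeightOneSpectrum (NumberField.RingOfIntegers K), Valued.v ((ϖ v : (v.adicCompletion K)ˣ) : v.adicCompletion K) = WithZero.exp (-1 : ℤ)) ∧ Literature.NumberTheory.Automorphic.IsHeckePoint (Matrix.GeneralLinearGroup.map (n := Fin 2) (algebraMap K (IsDedekindDomain.FiniteAdeleRing (NumberField.RingOfIntegers K) K))) (Literature.NumberTheory.Automorphic.LevelTower.ofSeq U (fun r : ℕ => (Literature.NumberTheory.Automorphic.principalCongruenceLevel 2 K (Ideal.span {((p : ℕ) : NumberField.RingOfIntegers K)} ^ r)).map (Literature.NumberTheory.Automorphic.GLn.sndHom 2 K))) ((p : ℕ) : (Valued.v (R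 := PadicAlgCl p)).valuationSubring) (fun j : {v : IsDedekindDomain.HeightOneSpectrum (NumberField.RingOfIntegers K) // v ∉ S} × Fin 2 => Literature.NumberTheory.Automorphic.GLn.sndHom 2 K (Literature.NumberTheory.Automorphic.heckeDiagAt 2 K j.1.1 (ϖ j.1.1) (j.2.val + 1))) (fun j => a j.1 (j.2.val + 1)) ∧ ∀ (v : IsDedekindDomain.HeightOneSpectrum (NumberField.RingOfIntegers K)) (hv : v ∉ S), σ.IsHeckeAssociatedAt v (fun i : ℕ => if i = 0 then (1 : PadicAlgCl p) else ((a ⟨v, hv⟩ i : (Valued.v (R := PadicAlgCl p)).valuationSubring) : PadicAlgCl p))) → ∃ (hcpt : Literature.NumberTheory.Automorphic.isCompact_glFiniteIntegralLevel 2 K) (π : Literature.NumberTheory.Automorphic.CuspidalAutomorphicRepData 2 K hcpt), ∀ᶠ w : IsDedekindDomain.HeightOneSpectrum (NumberField.RingOfIntegers K) in Filter.cofinite, SatakeFrobCompatibleAt ι π.1 σ w)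

set_option quotPrecheck false in
local notation "IcosahedralQuadraticDescent" =>
  (∀ (ι : PadicAlgCl 2 ≃+* ℂ) (ρ : Literature.NumberTheory.GaloisRepresentations.FramedGaloisRep ℚ ℂ 2), ρ.toGaloisRep.IsIrreducible → Nonempty ((Matrix.ProjGenLinGroup.mk.comp ρ.toMonoidHom).range ≃* alternatingGroup (Fin 5)) → (∀ (K : Type) [Field K] [NumberField K], NumberField.IsTotallyComplex K → Module.finrank ℚ K = 2 → (∃ v w : IsDedekindDomain.HeightOneSpectrum (NumberField.RingOfIntegers K), v ≠ w ∧ ((2 : ℕ) : NumberField.RingOfIntegers K) ∈ v.asIdeal ∧ ((2 : ℕ) : NumberField.RingOfIntegers K) ∈ w.asIdeal) → ∃ (σ : Literature.NumberTheory.GaloisRepresentations.FramedGaloisRep K (PadicAlgCl 2) 2) (hcpt : Literature.NumberTheory.Automorphic.isCompact_glFiniteIntegralLevel 2 K) (π : Literature.NumberTheory.Automorphic.CuspidalAutomorphicRepData 2 K hcpt), (∀ (g : Field.absoluteGaloisGroup K) (i j : Fin 2), ι ((σ g).val i j) = ((Literature.NumberTheory.GaloisRepresentations.FramedGaloisRep.restrictField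 K ρ) g).val i j) ∧ ∀ᶠ w : IsDedekindDomain.HeightOneSpectrum (NumberField.RingOfIntegers K) in Filter.cofinite, Summit.Langlands.SatakeFrobCompatibleAt ι π.1 σ w) → ∃ (hcpt : Literature.NumberTheory.Automorphic.isCompact_glFiniteIntegralLevel 2 ℚ) (π : Literature.NumberTheory.Automorphic.CuspidalAutomorphicRepData 2 ℚ hcpt), (∀ᶠ v : IsDedekindDomain.HeightOneSpectrum (NumberField.RingOfIntegers ℚ) in Filter.cofinite, ∃ α : Multiset ℂ, π.1.HasSatakeParamAt v α ∧ ρ.IsUnramifiedAt v ∧ ρ.HasFrobCharpolyAt v (Literature.NumberTheory.Automorphic.satakePolynomial α)))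

set_option quotPrecheck false in
local notation "EvenIcosahedralFromBianchi" =>
  (ResidualBianchiDoorMod2 → TwoAdicBianchiProModularity → ArtinWeightRealisation → IcosahedralQuadraticDescent → EvenIcosahedralStrongArtin)

/-- **Glue of route ParityBlindBianchi** (item `stmt-Langlands-14458`): the residual door mod `2`,
`2`-adic Bianchi pro-modularity, realisation at the Artin weight and icosahedral quadratic descent
together imply strong Artin (Tunnell's a.e. sense) for every irreducible even icosahedral
`ρ : Γ_ℚ → GL₂(ℂ)`. The abstract isomorphism `ℚ̄₂ ≃+* ℂ` comes from
`PadicAlgCl.nonempty_ringEquiv_complex`; the evenness hypothesis is not used. -/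
theorem EvenIcosahedralFromBianchi_proof : EvenIcosahedralFromBianchi := by
  intro hE1 hE2 hR hD ρ hirr hico _heven
  obtain ⟨ι⟩ := PadicAlgCl.nonempty_ringEquiv_complex 2
  refine hD ι ρ hirr hico ?_
  intro K _ _ htc hdeg hsplit
  obtain ⟨σ, hmodel, hfin, hσirr, hσico, hres⟩ := hE1 ι ρ hirr hico K htc hdeg hsplit
  have hpt := hE2 K htc hdeg hsplit ι σ hfin hσirr hσico hres
  obtain ⟨hcpt, π, hπ⟩ := hR K htc hdeg 2 ι σ hfin hσirr hpt
  exact ⟨σ, hcpt, π, hmodel, hπ⟩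

end Summit.Langlands.Langlands.Theorems
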